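import Literature.AlgebraicGeometry.Resolution.PointBlowupAdaptedOrder
import Mathlib.LinearAlgebra.Dimension.Finrank
import Mathlib.RingTheory.Adjoin.Basic

/-!
# The directrix `Vdir(x)`, `τ'(x)` and the projection number `κ(x) ∈ {2,3,4}` of Cossart–Piltant (statement-level typing)

`PointBlowupAdaptedOrder` types, for a state `h = x^q + F(u)` of Hauser's point-blowup walk read
with a boundary `E` of coordinate hyperplanes, the adapted numbers `(H, ε, ω)` of
[Cossart–Piltant 2019, ch. 2] in their case `G = 0` and the cone `Max(x)` through its generators
`coneGens E F` (forms of the single degree `ω(x)`).  This file adds, at the same statement level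
and in the SAME given coordinates (`T = id`, `B = ∅`, perfect residue field so that no
"derivation w.r.t. a constant" occurs):

* `Vdir I` — [CoP 2019, Def. 2.12] verbatim: the smallest subspace `W` of linear forms with
  `I = (I ∩ k[W]) R`, typed as an infimum of submodules of the coefficient space `σ → K` of linear
  forms (`linearForm w = Σ_i w_i U_i`); `tau I = dim Vdir I`;
* `VdirAt E s`, `tauPrime E s` — [CoP 2019, Def. 2.17]: `Vdir(x)`, `τ'(x)` of the cone ideal at `x`;
* `annihilatorForms`, `VdirEqAnnihilator gens` — the reading "`Vdir(I) = Ann T(k)`" for an ideal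
  generated by forms of ONE degree, `T(k) = {v : G(U+v) = G(U) ∀ G ∈ gens}` the `k`-rational points
  of `Max(I)` ([CoP 2019, Def. 2.13]; `InMax` of `PointBlowupAdaptedOrder`), recorded as a
  PROPOSITION with its hypothesis built in (proved on paper in the atlas' INVARIANTS-g5 §31 R1 over
  any field; NOT proved here and used as a hypothesis NOWHERE in the tree);
* `KappaFour` — [CoP 2019, Def. 5.1]: `κ(x) = 4 iff Vdir(x) ⊆ ⟨U_j : j ∈ E⟩` (verbatim);
* `KappaThreeWitness`, `KappaThree`, `kappa` — Def. 5.1's `κ = 3` clause read through the linear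
  test of INVARIANTS-g5 §31 R3 (the "there exists well adapted coordinates" of clause (1) becomes
  "there exists a vector `v` with `v_{j₁} = 0` leaving the cone invariant and with
  `D_v F_{p,Z} ∈ k · U_{j₁}^{H_{j₁}+ω}`"), and `κ := 4 / 3 / 2` (n = 3);
* `kappaCodimTwo` — [CoP 2019, Rem. 5.1] (n = 2);
* the edge predicates `KappaIncreases`, `IotaIncreases` (lexicographic `ι = (m, ω, κ)` at constant
  `m`), and `PhenomenonIII` — the authors' own "(iii) blowing up a monic form along a permissible
  center (e.g. a closed point) may lead to a bigger value `ι(x') = (p, ω(x), 4) > ι(x)` when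
  `κ(x) = 2,3`" typed as a predicate on one step.  NOTHING about `κ` is asserted: [CoP 2019] claim
  no monotonicity of the fine `κ` ("We claim no further invariance property … when `κ(y) ≥ 2`"), and
  the `κ` of their Thm. 3.6 is the coarse `κ ∈ {1, ≥ 2}` of Def. 2.16, constant `≥ 2` here (`G = 0`).

Relation to existing tree declarations (nothing is re-proved here).  `HironakaDirectrix.lean`
(same directory) types Hironaka's INTRINSIC directrix over `Fin d → k` with a formal translation
variable `T`: `invarianceSpace k S` (the vectors `w` with `F(Y + Tw) = F(Y)`, a `Submodule`, closure
proved there), `directrix k S := (invarianceSpace k S).dualAnnihilator ⊆ Module.Dual k (Fin d → k)`,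
`hironakaTau`, `linearFormsSubalgebra k T' = k[T']` and the minimality half `directrix_le_of_subset`.
The present file needs the `σ`-indexed, coefficient-vector form because the walk it reads —
`State σ K`, `step`, `newBoundary`, `coneGens`, `InMax`/`OnAdaptedCone` of `Hauser2010` /
`PointBlowupAdaptedOrder` — is `σ`-indexed and uses the RATIONAL translation `translate v : U ↦ U + v`
(for forms, rational invariance at `v` is equivalent to formal invariance along the line `kv`,
INVARIANTS-g5 §31 Lemma A, so `{v | OnAdaptedCone E s v}` is the set of `k`-points of
`invarianceSpace` of the cone generators after reindexing); and it types [CoP 2019]'s OWN Def. 2.12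
(`Vdir` = the minimal `W` with `I = (I ∩ k[W])R`), which the tree does not have — `polysIn W` is the
`σ`-indexed counterpart of `linearFormsSubalgebra`, and `VdirEqAnnihilator` is precisely the statement
that Def. 2.12's `Vdir` is the annihilator-directrix of `HironakaDirectrix` (both halves).  The
computable twin with kernel-checked rows (the five sample initial forms of [CoP 2019, p. 7] among
them) is `KangarooAtlasCertProjectionNumber`.
-/

noncomputable section

open MvPolynomial Finset

open scoped BigOperators

namespace Literature.AlgebraicGeometry.Resolution

open Literature.AlgebraicGeometry.Resolution.Hauser2010
open Literature.AlgebraicGeometry.Resolution.HauserPerlega2019 (initialForm)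

namespace PointBlowup

variable {σ : Type*} {K : Type*} [Field K]

/-! ### `Vdir(I)`, `τ(I)` (Def. 2.12) -/

variable [Fintype σ]

/-- the linear form `ℓ_w := Σ_i w_i U_i ∈ R₁` with coefficient vector `w`. [folklore] -/
def linearForm (w : σ → K) : MvPolynomial σ K :=
  ∑ i, C (w i) * X i

/-- `k[W] ⊆ k[U₁,…,U_n]`: the subalgebra generated by the linear forms of `W ⊆ R₁`
(`R = k[R₁]` the symmetric algebra); the `σ`-indexed counterpart of `linearFormsSubalgebra` of
`HironakaDirectrix.lean` (there over `Fin d`, `W ⊆ Module.Dual k (Fin d → k)`). [cite: CossartPiltant2019, Def. 2.12] -/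
def polysIn (W : Submodule K (σ → K)) : Subalgebra K (MvPolynomial σ K) :=
  Algebra.adjoin K (linearForm '' (W : Set (σ → K)))

/-- "`I = (I ∩ k[W]) R`": the homogeneous ideal `I` is generated by its elements lying in `k[W]`. [cite: CossartPiltant2019, Def. 2.12] -/
def GeneratedIn (I : Ideal (MvPolynomial σ K)) (W : Submodule K (σ → K)) : Prop :=
  I = Ideal.span ((I : Set (MvPolynomial σ K)) ∩ (polysIn W : Set (MvPolynomial σ K)))

/-- **Def. 2.12**: "The directrix `Vdir(I)` of `C = C(I)` is the smallest `k`-vector subspace `W` of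
`R₁` such that `I = (I ∩ k[W]) R`" — typed as the infimum of all such `W` (for a homogeneous ideal
the family is closed under intersection, Hironaka–Giraud, so the infimum belongs to it; that fact
is not re-proved here). [cite: CossartPiltant2019, Def. 2.12] -/
def Vdir (I : Ideal (MvPolynomial σ K)) : Submodule K (σ → K) :=
  sInf {W | GeneratedIn I W}

/-- `τ(I) := dim_k Vdir(I)`. [cite: CossartPiltant2019, Def. 2.12] -/
def tau (I : Ideal (MvPolynomial σ K)) : ℕ :=
  Module.finrank K (Vdir I)

/-- the annihilator in `R₁` of a set of vectors: `{ℓ_w : ℓ_w(v) = Σ_i w_i v_i = 0 ∀ v ∈ T}` (as coefficient vectors). [folklore] -/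
def annihilatorForms (T : Set (σ → K)) : Set (σ → K) :=
  {w | ∀ v ∈ T, ∑ i, w i * v i = 0}

/-- **`Vdir(I) = Ann T(k)` for an ideal generated by forms of one degree** — a PROPOSITION, with its
hypothesis built in, NOT proved in this file and used as a hypothesis nowhere in the tree.
Setting: "Given a fixed degree `d ≥ 1` and an ideal `I = (F_1, …, F_m) ⊂ R` defined by homogeneous
polynomials `F_1, …, F_m ∈ R`, `deg F_i = d` …, we let `Max(I) := {x ∈ 𝐕 : ord_x F_i = d, 1 ≤ i ≤ m}`"
(Def. 2.13); its `k`-rational points are the vectors `v` with `F_i(U + v) = F_i(U)` for all `i`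
(`InMax`), here `T(k)`; "(Hironaka) [H4] … `Dir(F) ⊆ Max(F) ⊆ C(F)`. If `k` is perfect … the left hand
side inclusion is an equality" (Prop. 2.15).  The `k`-RATIONAL statement typed here — Def. 2.12's
`Vdir(I)` is the annihilator in `R₁` of `T(k)`, hence `τ(I) = n − dim_k T(k)` — holds over every field
`k` (paper proof: atlas INVARIANTS-g5 §31, Lemma A = Hasse–Taylor expansion along one rational
invariance vector, Lemma B, Prop. R1; it is the conjunction of `directrix_le_of_subset` of
`HironakaDirectrix.lean` with the half `S ⊆ k[T(S)]` not vendored there).  The one-degree hypothesis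
cannot be dropped: for `gens = {U₁, U₁U₂}` (so `I = (U₁)`, `Vdir(I) = ⟨U₁⟩`) no `v ≠ 0` fixes `U₁U₂`,
so `Ann T(k) = R₁`; and for a non-homogeneous `U₁² + U₂` in characteristic `2`, `T(k) = {(t, t²)}` is
not even a subspace.  The computable twin's enumeration of `T(k)` over a finite `k`
(`KangarooAtlasCert.invVectors`, `tauPrime`) is the finite-field instance of this reading. [cite: CossartPiltant2019, Def. 2.12, Def. 2.13, Prop. 2.15] -/
def VdirEqAnnihilator (gens : Set (MvPolynomial σ K)) : Prop :=
  (∃ d : ℕ, ∀ G ∈ gens, G.IsHomogeneous d) →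
    (Vdir (Ideal.span gens) : Set (σ → K)) = annihilatorForms {v | ∀ G ∈ gens, InMax G v}

/-! ### `Vdir(x)`, `τ'(x)` (Def. 2.17) and the projection number (Def. 5.1, Rem. 5.1) -/

variable [DecidableEq σ]

/-- the cone ideal at `x` (`G = 0`, `T = id`, `B = ∅`, `Λ₀ = ∅`): generated by `V(F_{p,Z},E,m_S)` if
`ω = ε − 1`, by `J(F_{p,Z},E,m_S)` if `ω = ε` — i.e. by `coneGens E F`. [cite: CossartPiltant2019, Def. 2.17] -/
def coneIdeal (E : Finset σ) (F : MvPolynomial σ K) : Ideal (MvPolynomial σ K) :=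
  Ideal.span (coneGens E F)

/-- **`Vdir(x)`**: "We let `Vdir(x)` to be the underlying vector space of `Dir(x)`", `Dir(x) = Dir` of
the cone ideal (with `U_B`, here `B = ∅`). [cite: CossartPiltant2019, Def. 2.17] -/
def VdirAt (E : Finset σ) (s : State σ K) : Submodule K (σ → K) :=
  Vdir (coneIdeal E s.F)

/-- **`τ'(x) := dim_{k(x)} Vdir(x)`**. [cite: CossartPiltant2019, Def. 2.17] -/
def tauPrime (E : Finset σ) (s : State σ K) : ℕ :=
  Module.finrank K (VdirAt E s)

/-- `⟨U_j : j ∈ E⟩ ⊆ R₁`: the span of the boundary coordinates (as coefficient vectors). [cite: CossartPiltant2019, Def. 5.1] -/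
def boundarySpan (E : Finset σ) : Submodule K (σ → K) :=
  Submodule.span K ((fun j => (Pi.single j (1 : K) : σ → K)) '' (E : Set σ))

/-- **`κ(x) = 4`**: "We let `κ(x) := 4` if `Vdir(x) ⊆ ⟨U₁,…,U_e⟩`" (`E = div(u₁⋯u_e)`). [cite: CossartPiltant2019, Def. 5.1] -/
def KappaFour (E : Finset σ) (s : State σ K) : Prop :=
  VdirAt E s ≤ boundarySpan E

/-- the directional derivative `D_v Φ := Σ_i v_i ∂Φ/∂U_i` (= `∂/∂U'₂` for coordinates with `v` as
second dual basis vector). [folklore] -/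
def dirDeriv (v : σ → K) (Φ : MvPolynomial σ K) : MvPolynomial σ K :=
  ∑ i, C (v i) * pderiv i Φ

/-- witness of Def. 5.1 clause (1) (`E = div(u_{j₁})`) in the reading of INVARIANTS-g5 §31 R3: a
vector `v ≠ 0` with `v_{j₁} = 0` which leaves every cone generator translation invariant
("`Vdir(x) ⊆ ⟨U'₁, U'₃⟩`" for coordinates with `U'₂`-direction `v`) and with
`D_v F_{p,Z} = c · U_{j₁}^{H_{j₁} + ω(x)}`, `c = 0` allowed ("`H⁻¹ ∂F_{p,Z}/∂U'₂ ⊆ ⟨U₁^{ω(x)}⟩`").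
The invariance clause is `OnAdaptedCone E s v` of `PointBlowupAdaptedOrder` (`v ∈ Max(x)(k)`).
`bigH`, `omega` are `ℕ∞`-valued and `.toNat` reads `⊤` (only for `F = 0`) as `0`: the predicate is
meaningful for `F ≠ 0`, `ω(x) > 0`, as everywhere in Def. 5.1. (derived reading) [cite: CossartPiltant2019, Def. 5.1] -/
def KappaThreeWitness (j₁ : σ) (E : Finset σ) (s : State σ K) (v : σ → K) : Prop :=
  v ≠ 0 ∧ v j₁ = 0 ∧ OnAdaptedCone E s v ∧
    ∃ c : K, dirDeriv v (initialForm s.F) =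
      C c * X j₁ ^ ((bigH s.F j₁).toNat + (omega E s).toNat)

/-- **`κ(x) = 3`** (n = 3): "Assume now that `κ(x) ≠ 4`. We let `κ(x) := 3` if (`ω(x) = ε(x) − 1` and one
of the following conditions is satisfied): (1) `E = div(u₁)` and there exists well adapted
coordinates … ; (2) `E = div(u₁u₂)`" — clause (1) in the reading R3, `ω = ε − 1` as `V ≠ 0`.
(derived reading of the coordinate clause) [cite: CossartPiltant2019, Def. 5.1] -/
def KappaThree (E : Finset σ) (s : State σ K) : Prop :=
  ¬ KappaFour E s ∧ VNonzero E s.F ∧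
    (E.card = 2 ∨ (E.card = 1 ∧ ∃ j₁ ∈ E, ∃ v, KappaThreeWitness j₁ E s v))

/-- the **projection number** for `n = 3` (`G = 0`, so `κ(x) ≥ 2`): `4`, else `3`, else
"Finally, we let `κ(x) := 2` if `κ(x) ≠ 3,4`". Meaningful when `m(x) = p`, `ω(x) > 0`,
`1 ≤ |E|` (condition (E)); `|E| = 3` gives `4`. [cite: CossartPiltant2019, Def. 5.1] -/
def kappa (E : Finset σ) (s : State σ K) : ℕ :=
  haveI := Classical.dec (KappaFour E s)
  haveI := Classical.dec (KappaThree E s)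
  if KappaFour E s then 4 else if KappaThree E s then 3 else 2

/-- **Remark 5.1** (codimension two, `n = 2`): "if `E_s = div(u₁u₂)`, let `κ(y) := 4`; if
`E_s = div(u₁)`, let: `κ(y) := 2` if `ω(y) = ε(y)` and `Vdir(y) ⊄ ⟨U₁⟩`; `3` if `ω(y) = ε(y) − 1`;
`4` if `ω(y) = ε(y)` and `Vdir(y) = ⟨U₁⟩`". Meaningful for `|E| ∈ {1,2}` and `ω(y) > 0`: the last
`else` branch also returns `2` when `ω = ε` and `Vdir(y) = 0 ⊊ ⟨U₁⟩`, a case the Remark leaves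
undefined and which does not occur at the atlas' prepared states with `ω(y) > 0` (the cone ideal is
generated by forms of degree `ω(y) ≥ 1`; were they all zero, every partial derivative of the initial
form would vanish, i.e. it would be a `p`-th power over the perfect `k`, which the cleaning excludes;
so `Vdir(y) ≠ 0` there). [cite: CossartPiltant2019, Rem. 5.1] -/
def kappaCodimTwo (E : Finset σ) (s : State σ K) : ℕ :=
  haveI := Classical.dec (VNonzero E s.F)
  haveI := Classical.dec (VdirAt E s = boundarySpan E)
  if E.card = 2 then 4
  else if VNonzero E s.F then 3
  else if VdirAt E s = boundarySpan E then 4 else 2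

/-! ### Edge predicates: `κ` and `ι = (m, ω, κ)` along one step of the walk -/

variable [DecidableEq K]

/-- `κ` **increases** at the point `b` of the chart `u_j` (boundaries transported), for a chosen
`κ`-reading `κf` (`kappa` when `n = 3`, `kappaCodimTwo` when `n = 2`). [cite: CossartPiltant2019, Def. 5.1] -/
def KappaIncreases (κf : Finset σ → State σ K → ℕ) (q : ℕ) (j : σ) (b : σ → K) (E : Finset σ)
    (s : State σ K) : Prop :=
  κf E s < κf (newBoundary j b E) (step q j b s)

/-- `ι = (m, ω, κ)` **increases** lexicographically at constant `m = p`: `ω` increases, or `ω`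
stalls and `κ` increases. [cite: CossartPiltant2019, Thm. 3.6] -/
def IotaIncreases (κf : Finset σ → State σ K → ℕ) (q : ℕ) (j : σ) (b : σ → K) (E : Finset σ)
    (s : State σ K) : Prop :=
  OmegaIncreases q j b E s ∨ (OmegaStalls q j b E s ∧ KappaIncreases κf q j b E s)

/-- The authors' phenomenon (iii), typed at one step: an equimultiple point where `ω(x) > 0`
stalls and `κ` jumps from `2` or `3` to `4` — "blowing up a monic form along a permissible center
(e.g. a closed point) may lead to a bigger value `ι(x') = (p, ω(x), 4) > ι(x)` when `κ(x) = 2,3`".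
A predicate the atlas COUNTS; the paper asserts its possibility, not its absence. [cite: CossartPiltant2019, §1 (iii)] -/
def PhenomenonIII (κf : Finset σ → State σ K → ℕ) (p : ℕ) (j : σ) (b : σ → K) (E : Finset σ)
    (s : State σ K) : Prop :=
  IsEquimultiplePoint p j b s ∧ 0 < omega E s ∧ omega E s ≠ ⊤ ∧ OmegaStalls p j b E s ∧
    κf E s ≤ 3 ∧ κf (newBoundary j b E) (step p j b s) = 4

end PointBlowup

end Literature.AlgebraicGeometry.Resolution

end
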